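import Mathlib

/-!
# THEOREM 3-L, finite-dimensional core: a Lyapunov (energy) inequality gives the semigroup bound
`‖u(t)‖_G ≤ e^{ωt} ‖u(0)‖_G` for every solution of `u' = A u` (cap g3, cell `ns-blowup`, 2026-08-26)

HONEST FRAMING (human ruling D-0035): nothing here is a claim about Navier–Stokes blow-up.
WHAT THIS IS NOT: not NS evidence. Kernel form of the ENERGY ARGUMENT of THEOREM 3-L
(`instab/INSTAB-BRIDGE.md` §11 l.108): if `G` is a Hermitian weight and the dissipativity
inequality `Re⟨Gx, Ax⟩ ≤ ω · Re⟨Gx, x⟩` holds for every vector `x` (hypothesis (L) with the shift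
`ω` moved to the right), then along ANY differentiable curve with `u'(t) = A u(t)` the `G`-energy
satisfies `⟨G u(t), u(t)⟩ ≤ e^{2ωt} ⟨G u(0), u(0)⟩` for `t ≥ 0`, and with equivalence constants
`m‖x‖² ≤ ⟨Gx, x⟩ ≤ M‖x‖²` one gets `‖u(t)‖² ≤ (M/m) e^{2ωt} ‖u(0)‖²`, i.e. the constant
`M_G = √(M/m)` of the certificate. Stated for matrices over `ℂ` and solution CURVES (no matrix
exponential is needed; the same three lines are the PDE proof on `D(A)`). The interval stage
(`HOME/cap/d2/d2_cert.py`, PREREG «D2-3L-X0») certifies exactly the two hypotheses below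
(dissipativity of `Herm(G(A − ω))` and the enclosures `m, M`).

* `hasDerivAt_quadForm` — `d/dt Re⟨G u, u⟩ = 2 Re⟨G u, u'⟩` for Hermitian `G`.
* `quadForm_le_exp_mul` — the Gronwall step: `Re⟨Gu(t),u(t)⟩ ≤ e^{2ωt} Re⟨Gu(0),u(0)⟩`.
* `normSq_le_exp_mul` — with `m, M`: `‖u(t)‖² ≤ (M/m)·e^{2ωt}·‖u(0)‖²` (`‖x‖² = Re⟨x, x⟩`).

Mathlib only; no new definitions.
-/

namespace Summit.NavierStokesRegularity.FluidComputer.LyapunovSemigroupBound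

open Matrix Complex

variable {n : Type*} [Fintype n]

/-- For a Hermitian `G`, the two cross terms agree in real part:
`Re (v'ᴴ G v) = Re (vᴴ G v')`. -/
theorem re_star_dotProduct_mulVec_comm (G : Matrix n n ℂ) (hG : G.IsHermitian) (v v' : n → ℂ) :
    (star v' ⬝ᵥ (G *ᵥ v)).re = (star v ⬝ᵥ (G *ᵥ v')).re := by
  have h : star v' ⬝ᵥ (G *ᵥ v) = star (star v ⬝ᵥ (G *ᵥ v')) := by
    rw [star_dotProduct, star_mulVec, ← dotProduct_mulVec, hG.eq]
  rw [h, Complex.star_def, Complex.conj_re]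

/-- **Derivative of the `G`-energy along a curve.** If `u` has derivative `u'` at `t` then
`s ↦ Re (u(s)ᴴ G u(s))` has derivative `2 Re (u(t)ᴴ G u')` at `t` (for Hermitian `G`). -/
theorem hasDerivAt_quadForm (G : Matrix n n ℂ) (hG : G.IsHermitian) {u : ℝ → n → ℂ}
    {u' : n → ℂ} {t : ℝ} (hu : HasDerivAt u u' t) :
    HasDerivAt (fun s => (star (u s) ⬝ᵥ (G *ᵥ u s)).re)
      (2 * (star (u t) ⬝ᵥ (G *ᵥ u')).re) t := by
  have hui : ∀ i, HasDerivAt (fun s => u s i) (u' i) t := fun i => (hasDerivAt_pi.1 hu) i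
  -- the complex-valued energy as an explicit double sum
  have hψ : HasDerivAt (fun s => ∑ i, ∑ j, star (u s i) * G i j * u s j)
      (∑ i, ∑ j, (star (u' i) * G i j * u t j + star (u t i) * G i j * u' j)) t := by
    refine HasDerivAt.fun_sum fun i _ => HasDerivAt.fun_sum fun j _ => ?_
    have h1 : HasDerivAt (fun s => star (u s i) * G i j) (star (u' i) * G i j) t :=
      (hui i).star.mul_const _
    have h2 := h1.mul (hui j)
    simpa [Pi.mul_def, mul_assoc, add_comm] using h2
  have hre := (Complex.reCLM.hasFDerivAt.comp_hasDerivAt t hψ)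
  have e1 : (fun s => (star (u s) ⬝ᵥ (G *ᵥ u s)).re)
      = (⇑Complex.reCLM ∘ fun s => ∑ i, ∑ j, star (u s i) * G i j * u s j) := by
    funext s
    simp only [Function.comp_apply, Complex.reCLM_apply, dotProduct, mulVec, Finset.mul_sum,
      Pi.star_apply, mul_assoc]
  have e2 : Complex.reCLM (∑ i, ∑ j, (star (u' i) * G i j * u t j + star (u t i) * G i j * u' j))
      = 2 * (star (u t) ⬝ᵥ (G *ᵥ u')).re := by
    have hsplit : (∑ i, ∑ j, (star (u' i) * G i j * u t j + star (u t i) * G i j * u' j))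
        = star u' ⬝ᵥ (G *ᵥ u t) + star (u t) ⬝ᵥ (G *ᵥ u') := by
      simp only [dotProduct, mulVec, Finset.mul_sum, Pi.star_apply, mul_assoc,
        Finset.sum_add_distrib]
    rw [Complex.reCLM_apply, hsplit, Complex.add_re, re_star_dotProduct_mulVec_comm G hG _ u']
    ring
  rw [e1, ← e2]
  exact hre

/-- **THEOREM 3-L (finite-dimensional core, Gronwall step).** Let `G` be Hermitian and suppose the
dissipativity inequality `Re (xᴴ G A x) ≤ ω · Re (xᴴ G x)` for all `x` (hypothesis (L) of
THEOREM 3-L, shift moved to the right). Then every solution curve `u' = A u` satisfies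
`Re (u(t)ᴴ G u(t)) ≤ e^{2ωt} · Re (u(0)ᴴ G u(0))` for `t ≥ 0`. -/
theorem quadForm_le_exp_mul (A G : Matrix n n ℂ) (hG : G.IsHermitian) (ω : ℝ)
    (hdiss : ∀ x : n → ℂ, (star x ⬝ᵥ (G *ᵥ (A *ᵥ x))).re ≤ ω * (star x ⬝ᵥ (G *ᵥ x)).re)
    {u : ℝ → n → ℂ} (hu : ∀ t, HasDerivAt u (A *ᵥ u t) t) {t : ℝ} (ht : 0 ≤ t) :
    (star (u t) ⬝ᵥ (G *ᵥ u t)).re ≤ Real.exp (2 * ω * t) * (star (u 0) ⬝ᵥ (G *ᵥ u 0)).re := by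
  set φ : ℝ → ℝ := fun s => (star (u s) ⬝ᵥ (G *ᵥ u s)).re with hφ
  have hφ' : ∀ s, HasDerivAt φ (2 * (star (u s) ⬝ᵥ (G *ᵥ (A *ᵥ u s))).re) s :=
    fun s => hasDerivAt_quadForm G hG (hu s)
  -- g(s) = e^{-2ωs} φ(s) is non-increasing
  set g : ℝ → ℝ := fun s => Real.exp (-(2 * ω * s)) * φ s with hg
  have hE : ∀ s, HasDerivAt (fun s => Real.exp (-(2 * ω * s))) (Real.exp (-(2 * ω * s)) * (-(2 * ω))) s := by
    intro s
    have h1 : HasDerivAt (fun s : ℝ => -(2 * ω * s)) (-(2 * ω)) s := by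
      have e : (fun s : ℝ => -(2 * ω * s)) = fun x => -(2 * ω) * x := by funext x; ring
      rw [e]; simpa using (hasDerivAt_id' s).const_mul (-(2 * ω))
    exact (Real.hasDerivAt_exp _).comp s h1 |>.congr_deriv (by ring)
  have hg' : ∀ s, HasDerivAt g (Real.exp (-(2 * ω * s)) * (-(2 * ω)) * φ s
      + Real.exp (-(2 * ω * s)) * (2 * (star (u s) ⬝ᵥ (G *ᵥ (A *ᵥ u s))).re)) s :=
    fun s => (hE s).mul (hφ' s)
  have hanti : Antitone g := by
    refine antitone_of_deriv_nonpos (fun s => (hg' s).differentiableAt) fun s => ?_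
    rw [(hg' s).deriv]
    have hex : 0 < Real.exp (-(2 * ω * s)) := Real.exp_pos _
    have := hdiss (u s)
    nlinarith [hex, this]
  have hmono := hanti ht
  simp only [hg, mul_zero, neg_zero, Real.exp_zero, one_mul] at hmono
  -- multiply through by e^{2ωt}
  have hex : 0 < Real.exp (2 * ω * t) := Real.exp_pos _
  have hprod : Real.exp (2 * ω * t) * Real.exp (-(2 * ω * t)) = 1 := by
    rw [← Real.exp_add]; simp
  calc φ t = Real.exp (2 * ω * t) * (Real.exp (-(2 * ω * t)) * φ t) := by
        rw [← mul_assoc, hprod, one_mul]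
    _ ≤ Real.exp (2 * ω * t) * φ 0 := mul_le_mul_of_nonneg_left hmono hex.le

/-- **THEOREM 3-L (finite-dimensional core, with equivalence constants).** Under the hypotheses of
`quadForm_le_exp_mul` and `m ‖x‖² ≤ Re (xᴴ G x) ≤ M ‖x‖²` with `m > 0` (`‖x‖² := Re (xᴴ x)`), every
solution curve satisfies `‖u(t)‖² ≤ (M/m) e^{2ωt} ‖u(0)‖²`, i.e. `‖u(t)‖ ≤ √(M/m)·e^{ωt}·‖u(0)‖`:
the certified constant `M_G = √(M/m)`. -/
theorem normSq_le_exp_mul (A G : Matrix n n ℂ) (hG : G.IsHermitian) (ω m M : ℝ) (hm : 0 < m)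
    (hdiss : ∀ x : n → ℂ, (star x ⬝ᵥ (G *ᵥ (A *ᵥ x))).re ≤ ω * (star x ⬝ᵥ (G *ᵥ x)).re)
    (hlow : ∀ x : n → ℂ, m * (star x ⬝ᵥ x).re ≤ (star x ⬝ᵥ (G *ᵥ x)).re)
    (hup : ∀ x : n → ℂ, (star x ⬝ᵥ (G *ᵥ x)).re ≤ M * (star x ⬝ᵥ x).re)
    {u : ℝ → n → ℂ} (hu : ∀ t, HasDerivAt u (A *ᵥ u t) t) {t : ℝ} (ht : 0 ≤ t) :
    (star (u t) ⬝ᵥ u t).re ≤ M / m * Real.exp (2 * ω * t) * (star (u 0) ⬝ᵥ u 0).re := by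
  have h1 := quadForm_le_exp_mul A G hG ω hdiss hu ht
  have h2 := hlow (u t)
  have h3 := hup (u 0)
  have hex : 0 < Real.exp (2 * ω * t) := Real.exp_pos _
  have h4 : m * (star (u t) ⬝ᵥ u t).re ≤ Real.exp (2 * ω * t) * (M * (star (u 0) ⬝ᵥ u 0).re) :=
    h2.trans (h1.trans (mul_le_mul_of_nonneg_left h3 hex.le))
  rw [div_mul_eq_mul_div, div_mul_eq_mul_div, le_div_iff₀ hm]
  linarith

end Summit.NavierStokesRegularity.FluidComputer.LyapunovSemigroupBound
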